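import Summits.BirchSwinnertonDyer.BirchSwinnertonDyer.Theorems.GenusKolyvaginAtTwoSupplyKernelsLossless
import HarnessLib

/-!
# Route `GenusKolyvaginAtTwo`: the HEEGNER VALUATION LEDGER at `2` — `2·M₀ = ord₂ #Ш_an(E) + ord₂ #Ш_an(E^(d_K))` up to the three
# algebraic `Ш[2^∞]` — modulo the route's four PRINT items (Gross–Zagier, GZK, modularity, Milne any-model)

LEAD seat `bsd-line-gk2-p1` g26 (cell `bsd-f1-sign2`), route `GenusKolyvaginAtTwo` rev 59.  THEOREMS ONLY (no definition, no named fact, no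
`sorry`).  **BSD is NOT proved by this file; no item is closed by it.**  Every theorem is CONDITIONAL on the route's four print items
`GrossZagierAllLevels` (24148), `MultPublishedInputsAtTwo` (19921), `EntireLFunctionRat` (19273), `MilneAnyModel` (24149) — displayed as binders.

WHAT.  The pen's four new lines on the kernel items (LINE 30 «su_halves» on K₁⁻ 31525, LINE 31 on K₁⁺ 31468, LINE 29 «frame_rigidity» on K₄⁺
31469, LINE 32 on K₄⁻ 31526) each carry a «PRINT-ledger» stub (G′ `stub_valuationLedger`, F2L `stub_twoFrameLedger`).  All four are instances
of ONE identity, proved here once: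

* §1 `master_ledger` — at every supply frame (`E = W/ℚ` globally minimal of analytic rank `0`, `ρ̄_{E,2}` onto, `C(E)` odd; `K` imaginary
  quadratic, `d_K` odd `≠ −3`, Heegner for `N_E`; a datum `Dt` with ODD Manin constant, `d₁` conductor-`1` with `2^(M₀) ∥ P(1)`; a globally
  minimal twin `Wd ≅ E^(d_K)` of analytic rank `1`; `#Ш_an(Wd) = qd ∈ ℚ`):  `#Ш_an(E) = qW ∈ ℚ` and
  **`2·M₀ + ord₂ #Ш(E/ℚ)[2^∞] + ord₂ #Ш(Wd/ℚ)[2^∞] = ord₂ qW + ord₂ qd + ord₂ #Ш(E_K/K)[2^∞]`**, all three `Ш` finite.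
  Proof = Gross–Zagier over `K` read for the rank-zero member (`RankOneAtTwoOneDoor.padicValRat_shaAnOverC_heegnerC`: `ord₂ #Ш_an(E_K) = 2M₀ − 2v₂(c)`)
  + Milne's any-model Weil-restriction identity in its exact defect form (`AdditivePotMult.shaAnOverC_mul_eq`:
  `#Ш_an(E_K)·#Ш(E)·#Ш(Wd) = #Ш_an(E)·#Ш_an(Wd)·#Ш(E_K)`) + `ord₂ #Ш = ord₂ #Ш[2^∞]`.  NO Tamagawa number of the twin, NO cut, NO Q2 enter.
* §2 `two_mul_depth_eq_padicValRat_add` — hence **`2·M₀ = ord₂ qW + ord₂ qd`** whenever `Ш(Wd/ℚ)[2^∞] = 0` and `#Ш(E_K/K)[2^∞] = #Ш(E/ℚ)[2^∞]`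
  (the K₁ cells: all three trivial — Lossless §1 + `#Sel₂(E) = 1`; the K₄ cells: gk2-p4 g29's cell laws
  `ShaCores.natCard_shaPrimary_baseChange_eq_rat_of_kFour{Neg,Pos}_cell`); `primaryComponent_sha_two_eq_bot_of_rank_one` discharges `Ш(Wd)[2^∞] = 0`
  from `rank Wd(ℚ) = 1 ∧ #Sel₂(Wd) = 2` (descent count).
READING: the four «print» stubs are bookkeeping over landed theorems (landed separately, VERBATIM, one file per line); the lines' open content is
A / B1′ / B3 (LINE 30/31) and F1 / F2T / F2Z / F4 (LINE 29/32) — unchanged.  The identity also says: on the K₄ cells `4^(M₀) = 2^(ord₂ #Ш_an(E) +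
ord₂ #Ш_an(Wd))` unconditionally mod PRINT, so the LEAD table's face «K4 ⟺ #Ш(E/ℚ)[2^∞] = 4^(M₀)» reads «K4 ⟺ ord₂ #Ш(E/ℚ)[2^∞] = ord₂ #Ш_an(E) +
ord₂ #Ш_an(Wd)» — BSD₂(E) and BSD₂(Wd) become EQUIVALENT at a witnessed frame.  Nothing here decides them.

References: [GrossZagier1986] V §2 (2.2); [GrossLMS1991] §2 Conj. (2.2); [McCallumLMS1991] §5 Lemma 5.1; [Milne1972ArithmeticAV] §1 Thm. 1;
[DokchitserDokchitserAnnals2010] §2.1; [Miller2011LMS] Def. 1.1; [SilvermanAEC2009] Thm. X.4.2.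
-/

set_option autoImplicit false
set_option linter.dupNamespace false -- `Summit.<P>.<Sub>` repeats `BirchSwinnertonDyer` (D-0017)

noncomputable section

open scoped Classical

namespace Summit.BirchSwinnertonDyer.BirchSwinnertonDyer.Theorems.GenusExact.ValuationLedger

open WeierstrassCurve NumberField Literature.NumberTheory.EllipticCurves Literature.NumberTheory.EllipticCurves.ModularForms
  Literature.NumberTheory.GaloisRepresentations
  Summit.BirchSwinnertonDyer.Rank1Residual
  Summit.BirchSwinnertonDyer.Rank1Residual.AdditivePotMult
  Summit.BirchSwinnertonDyer.BirchSwinnertonDyer.Theses.GenusKolyvaginAtTwo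
  Summit.BirchSwinnertonDyer.BirchSwinnertonDyer.Theorems.RankOneAtTwoOneDoor

/-! ## §0 `Ш(Wd/ℚ)[2^∞] = 0` for a rank-one curve with `#Sel₂ = 2` -/

/-- **Descent count**: an elliptic `V/ℚ` with `rank V(ℚ) = 1` and `#Sel₂(V) = 2` has `Ш(V/ℚ)[2^∞] = 0` (`#Sel₂ = 2^rank · #V(ℚ)[2] · #Ш[2]`
forces `#Ш(V)[2] = 1`, and no `2`-torsion means no `2`-primary part).  [cite: SilvermanAEC2009, Thm. X.4.2] -/
theorem primaryComponent_sha_two_eq_bot_of_rank_one (V : WeierstrassCurve ℚ) [V.IsElliptic] (hrk : V.mordellWeilRank = 1)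
    (hSel : Nat.card (V.selmerGroup 2) = 2) : AddCommGroup.primaryComponent (↥V.sha) 2 = ⊥ := by
  haveI : Fact (Nat.Prime 2) := ⟨Nat.prime_two⟩
  have hcount := V.natCard_selmerGroup_eq (n := 2) two_ne_zero
  have hSel' : Nat.card (V.selmerGroup ((2 : ℕ) : ℤ)) = 2 := by rw [Nat.cast_ofNat]; exact hSel
  rw [hSel', hrk, pow_one, mul_assoc] at hcount
  have hprod := Nat.eq_of_mul_eq_mul_left two_pos ((mul_one 2).trans hcount)
  exact primaryComponent_sha_eq_bot_of_inf_torsionBy_eq_bot V 2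
    (AddSubgroup.eq_bot_of_card_eq _ (Nat.eq_one_of_mul_eq_one_left hprod.symm))

/-- Cardinality form of `primaryComponent_sha_two_eq_bot_of_rank_one`: `#Ш(V/ℚ)[2^∞] = 1`. [cite: SilvermanAEC2009, Thm. X.4.2] -/
theorem natCard_primaryComponent_sha_two_eq_one_of_rank_one (V : WeierstrassCurve ℚ) [V.IsElliptic] (hrk : V.mordellWeilRank = 1)
    (hSel : Nat.card (V.selmerGroup 2) = 2) : Nat.card (AddCommGroup.primaryComponent (↥V.sha) 2) = 1 := by
  rw [primaryComponent_sha_two_eq_bot_of_rank_one V hrk hSel]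
  exact AddSubgroup.card_bot

/-! ## §1 The master ledger -/

/-- **THE HEEGNER VALUATION LEDGER AT `2` (master form), modulo PRINT.**  `E = W/ℚ` globally minimal of analytic rank `0` with `ρ̄_{E,2}` onto and
odd Tamagawa product; `K` imaginary quadratic with `d_K` odd, `≠ −3`, Heegner for `N_E`; `Dt` a datum with ODD Manin constant, `d₁` conductor-`1`
Kolyvagin data with `2^(M₀) ∥ P(1)` in `E(K[1])`; `Wd` a globally minimal model of `E^(d_K)` of analytic rank `1` with `#Ш_an(Wd) = qd ∈ ℚ`.  Then
`Ш(E/ℚ)`, `Ш(Wd/ℚ)`, `Ш(E_K/K)` are finite, `#Ш_an(E) = qW` is rational, and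
**`2·M₀ + ord₂ #Ш(E/ℚ)[2^∞] + ord₂ #Ш(Wd/ℚ)[2^∞] = ord₂ qW + ord₂ qd + ord₂ #Ш(E_K/K)[2^∞]`.**
Gross–Zagier V (2.2) over `K` (`u_K = 1`, `c` odd, `C(E)` odd, `[E(K) : ℤy_K]₂ = 2^(M₀)`: `ord₂ #Ш_an(E_K) = 2M₀`), Milne's Weil-restriction
identity on the canonical model in defect form, and `ord₂ #Ш = ord₂ #Ш[2^∞]` for finite `Ш`.  CONDITIONAL on the four print items; BSD is NOT
proved by this. [cite: GrossZagier1986, V §2 (2.2)] [cite: McCallumLMS1991, §5 Lemma 5.1] [cite: Milne1972ArithmeticAV, §1 Thm. 1]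
[cite: DokchitserDokchitserAnnals2010, §2.1] [cite: Miller2011LMS, Def. 1.1] -/
theorem master_ledger
    (hGZ : GrossZagierAllLevels) (hGZK : MultPublishedInputsAtTwo) (hL : EntireLFunctionRat) (hMi : MilneAnyModel)
    (W : WeierstrassCurve ℚ) [W.IsElliptic] [W.IsGloballyMinimal] [NeZero (W.conductorNorm ℤ)]
    (hρ2 : W.HasSurjectiveModNGaloisRep 2) (hT : Odd W.tamagawaProduct) (hr0 : W.analyticRank = 0)
    (K : Type) [Field K] [NumberField K] (hIQ : IsImaginaryQuadratic K) (hodd : Odd (NumberField.discr K))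
    (h3 : NumberField.discr K ≠ -3) (hHe : SatisfiesHeegnerHypothesis (W.conductorNorm ℤ) K)
    (Dt : ModularParametrizationData W (W.conductorNorm ℤ)) (hc : Odd Dt.c) (β : ℤ) (ι : K →+* ℂ)
    (d₁ : KolyvaginHeegnerData Dt β ι 1) {M₀ : ℕ}
    (hdiv : ∃ Q : (W.baseChange (ringClassField K ι 1)).toAffine.Point, ((2 ^ M₀ : ℕ) : ℤ) • Q = d₁.derivedPoint)
    (hndiv : ¬ ∃ Q : (W.baseChange (ringClassField K ι 1)).toAffine.Point, ((2 ^ (M₀ + 1) : ℕ) : ℤ) • Q = d₁.derivedPoint)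
    (Wd : WeierstrassCurve ℚ) [Wd.IsElliptic] [Wd.IsGloballyMinimal]
    (hWd : ∃ C : VariableChange ℚ, C • W.quadraticTwist (NumberField.discr K : ℚ) = Wd) (hrd : Wd.analyticRank = 1)
    {qd : ℚ} (hqd : shaAn Wd = (qd : ℂ)) :
    Finite (↥W.sha) ∧ Finite (↥Wd.sha) ∧ Finite (↥(W.baseChange K).sha) ∧
      ∃ qW : ℚ, shaAn W = (qW : ℂ) ∧
        2 * (M₀ : ℤ) + (padicValNat 2 (Nat.card (AddCommGroup.primaryComponent (↥W.sha) 2)) : ℤ) +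
            (padicValNat 2 (Nat.card (AddCommGroup.primaryComponent (↥Wd.sha) 2)) : ℤ) =
          padicValRat 2 qW + padicValRat 2 qd +
            (padicValNat 2 (Nat.card (AddCommGroup.primaryComponent (↥(W.baseChange K).sha) 2)) : ℤ) := by
  haveI : Fact (Nat.Prime 2) := ⟨Nat.prime_two⟩
  haveI hEK : (W.baseChange K).IsElliptic := inferInstanceAs ((W.map (algebraMap ℚ K)).IsElliptic)
  have h2 : Module.finrank ℚ K = 2 := hIQ.1
  have hD0 : (NumberField.discr K : ℚ) ≠ 0 := by exact_mod_cast NumberField.discr_ne_zero K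
  haveI hEt : (W.quadraticTwist (NumberField.discr K : ℚ)).IsElliptic := W.isElliptic_quadraticTwist hD0
  -- the twist itself has analytic rank `1`, so `ord_{s=1} L(E_K, s) = 1`
  have hrt : (W.quadraticTwist (NumberField.discr K : ℚ)).analyticRank = 1 := by
    obtain ⟨Cd, hCd⟩ := hWd
    rw [← hrd, ← hCd, analyticRank_smul]
  have hrK : (W.baseChange K).analyticRank = 1 :=
    (P2.analyticRank_baseChange_eq_one_iff W K hL h2).mpr (Or.inr ⟨hr0, hrt⟩)
  -- Gross–Zagier over `K`: `#Ш_an(E_K) = q'` with `ord₂ q' = 2 M₀ − 2 v₂(c) = 2 M₀`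
  obtain ⟨hShaK, q', hq', hval⟩ :=
    padicValRat_shaAnOverC_heegnerC W K Dt β ι d₁ (hGZ _ W K) hGZK hL hρ2 hT hIQ hodd h3 hHe hrK hdiv hndiv
  have hvc : padicValInt 2 Dt.c = 0 :=
    padicValInt.eq_zero_of_not_dvd (fun h2c ↦ (Int.not_even_iff_odd.mpr hc) (even_iff_two_dvd.mpr h2c))
  simp only [hvc, Nat.cast_zero, mul_zero, sub_zero] at hval
  -- finiteness over `ℚ` (Gross–Zagier–Kolyvagin)
  obtain ⟨-, hfinW⟩ := hGZK W (by rw [hr0]; exact zero_le_one)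
  obtain ⟨-, hfinD⟩ := hGZK Wd (by rw [hrd])
  haveI : Finite (↥W.sha) := hfinW
  haveI : Finite (↥Wd.sha) := hfinD
  haveI : Finite (↥(W.baseChange K).sha) := hShaK
  -- Milne's Weil-restriction identity on the canonical model, defect form
  have hV : ∃ C : VariableChange K, C • W.baseChange K = W.baseChange K := ⟨1, one_smul _ _⟩
  obtain ⟨-, hWR⟩ := hMi W K h2 Wd hWd (W.baseChange K) hV hfinW hfinD
  have hstar := shaAnOverC_mul_eq W K Wd (W.baseChange K) hL h2 hWd hV hfinW hfinD hWR
  -- `#Ш_an(E)` is rational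
  obtain ⟨qW, hqW⟩ : ∃ qW : ℚ, shaAn W = (qW : ℂ) :=
    ⟨_, exists_shaAn_eq_of_overC W K Wd (W.baseChange K) hL h2 hWd hV hfinW hfinD hShaK hWR hq' hqd⟩
  -- pass to `ℚ` and take `2`-adic valuations
  have hsW : W.shaOrder ≠ 0 := (W.shaOrder_pos hfinW).ne'
  have hsD : Wd.shaOrder ≠ 0 := (Wd.shaOrder_pos hfinD).ne'
  have hsK : (W.baseChange K).shaOrder ≠ 0 := ((W.baseChange K).shaOrder_pos hShaK).ne'
  have hqW0 : qW ≠ 0 := by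
    intro h0; apply shaAn_ne_zero W hL; rw [hqW, h0, Rat.cast_zero]
  have hqd0 : qd ≠ 0 := by
    intro h0; apply shaAn_ne_zero Wd hL; rw [hqd, h0, Rat.cast_zero]
  have hQ : q' * W.shaOrder * Wd.shaOrder = qW * qd * (W.baseChange K).shaOrder := by
    have h : ((q' * W.shaOrder * Wd.shaOrder : ℚ) : ℂ) = ((qW * qd * (W.baseChange K).shaOrder : ℚ) : ℂ) := by
      push_cast
      rw [← hqW, ← hq', ← hqd]
      exact hstar
    exact_mod_cast h
  have hsWq : (W.shaOrder : ℚ) ≠ 0 := by exact_mod_cast hsW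
  have hsDq : (Wd.shaOrder : ℚ) ≠ 0 := by exact_mod_cast hsD
  have hsKq : ((W.baseChange K).shaOrder : ℚ) ≠ 0 := by exact_mod_cast hsK
  have hq'0 : q' ≠ 0 := by
    intro h0
    rw [h0, zero_mul, zero_mul] at hQ
    exact mul_ne_zero (mul_ne_zero hqW0 hqd0) hsKq hQ.symm
  have hv := congrArg (padicValRat 2) hQ
  rw [padicValRat.mul (mul_ne_zero hq'0 hsWq) hsDq, padicValRat.mul hq'0 hsWq,
    padicValRat.mul (mul_ne_zero hqW0 hqd0) hsKq, padicValRat.mul hqW0 hqd0, hval,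
    padicValRat.of_nat, padicValRat.of_nat, padicValRat.of_nat,
    X11b.Three.Koly.padicValNat_shaOrder_eq W 2, X11b.Three.Koly.padicValNat_shaOrder_eq Wd 2,
    X11b.Three.Koly.padicValNat_shaOrder_eq (W.baseChange K) 2] at hv
  refine ⟨hfinW, hfinD, hShaK, qW, hqW, ?_⟩
  linarith

/-! ## §2 The ledger when the three algebraic `Ш[2^∞]` cancel -/

/-- **`2·M₀ = ord₂ #Ш_an(E) + ord₂ #Ш_an(Wd)`** at every supply frame (as in `master_ledger`) where `Ш(Wd/ℚ)[2^∞] = 0` and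
`#Ш(E_K/K)[2^∞] = #Ш(E/ℚ)[2^∞]` — the exact Heegner valuation ledger with the algebraic terms cancelled; `#Ш_an(E)` is rational.
On the K₁ cells all three `Ш[2^∞]` vanish; on the K₄ cells the equality is gk2-p4 g29's cell law.  CONDITIONAL on the four print items;
BSD is NOT proved by this. [cite: GrossZagier1986, V §2 (2.2)] [cite: Milne1972ArithmeticAV, §1 Thm. 1] [cite: Miller2011LMS, Def. 1.1] -/
theorem exists_two_mul_depth_eq_padicValRat_add
    (hGZ : GrossZagierAllLevels) (hGZK : MultPublishedInputsAtTwo) (hL : EntireLFunctionRat) (hMi : MilneAnyModel)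
    (W : WeierstrassCurve ℚ) [W.IsElliptic] [W.IsGloballyMinimal] [NeZero (W.conductorNorm ℤ)]
    (hρ2 : W.HasSurjectiveModNGaloisRep 2) (hT : Odd W.tamagawaProduct) (hr0 : W.analyticRank = 0)
    (K : Type) [Field K] [NumberField K] (hIQ : IsImaginaryQuadratic K) (hodd : Odd (NumberField.discr K))
    (h3 : NumberField.discr K ≠ -3) (hHe : SatisfiesHeegnerHypothesis (W.conductorNorm ℤ) K)
    (Dt : ModularParametrizationData W (W.conductorNorm ℤ)) (hc : Odd Dt.c) (β : ℤ) (ι : K →+* ℂ)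
    (d₁ : KolyvaginHeegnerData Dt β ι 1) {M₀ : ℕ}
    (hdiv : ∃ Q : (W.baseChange (ringClassField K ι 1)).toAffine.Point, ((2 ^ M₀ : ℕ) : ℤ) • Q = d₁.derivedPoint)
    (hndiv : ¬ ∃ Q : (W.baseChange (ringClassField K ι 1)).toAffine.Point, ((2 ^ (M₀ + 1) : ℕ) : ℤ) • Q = d₁.derivedPoint)
    (Wd : WeierstrassCurve ℚ) [Wd.IsElliptic] [Wd.IsGloballyMinimal]
    (hWd : ∃ C : VariableChange ℚ, C • W.quadraticTwist (NumberField.discr K : ℚ) = Wd) (hrd : Wd.analyticRank = 1)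
    {qd : ℚ} (hqd : shaAn Wd = (qd : ℂ))
    (hShaD : Nat.card (AddCommGroup.primaryComponent (↥Wd.sha) 2) = 1)
    (hShaK : ∀ [Finite (↥W.sha)] [Finite (↥(W.baseChange K).sha)],
      Nat.card (AddCommGroup.primaryComponent (↥(W.baseChange K).sha) 2) = Nat.card (AddCommGroup.primaryComponent (↥W.sha) 2)) :
    ∃ qW : ℚ, shaAn W = (qW : ℂ) ∧ 2 * (M₀ : ℤ) = padicValRat 2 qW + padicValRat 2 qd := by
  obtain ⟨hfinW, -, hfinK, qW, hqW, h⟩ :=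
    master_ledger hGZ hGZK hL hMi W hρ2 hT hr0 K hIQ hodd h3 hHe Dt hc β ι d₁ hdiv hndiv Wd hWd hrd hqd
  haveI := hfinW
  haveI := hfinK
  rw [hShaD, hShaK, padicValNat_one_right] at h
  refine ⟨qW, hqW, ?_⟩
  push_cast at h
  linarith

/-- **`2·M₀ = ord₂ qW + ord₂ qd` for GIVEN rational values** `#Ш_an(E) = qW`, `#Ш_an(Wd) = qd` (uniqueness of the rational value), in the setting of
`exists_two_mul_depth_eq_padicValRat_add`.  CONDITIONAL on the four print items; BSD is NOT proved by this.
[cite: GrossZagier1986, V §2 (2.2)] [cite: Milne1972ArithmeticAV, §1 Thm. 1] [cite: Miller2011LMS, Def. 1.1] -/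
theorem two_mul_depth_eq_padicValRat_add
    (hGZ : GrossZagierAllLevels) (hGZK : MultPublishedInputsAtTwo) (hL : EntireLFunctionRat) (hMi : MilneAnyModel)
    (W : WeierstrassCurve ℚ) [W.IsElliptic] [W.IsGloballyMinimal] [NeZero (W.conductorNorm ℤ)]
    (hρ2 : W.HasSurjectiveModNGaloisRep 2) (hT : Odd W.tamagawaProduct) (hr0 : W.analyticRank = 0)
    (K : Type) [Field K] [NumberField K] (hIQ : IsImaginaryQuadratic K) (hodd : Odd (NumberField.discr K))
    (h3 : NumberField.discr K ≠ -3) (hHe : SatisfiesHeegnerHypothesis (W.conductorNorm ℤ) K)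
    (Dt : ModularParametrizationData W (W.conductorNorm ℤ)) (hc : Odd Dt.c) (β : ℤ) (ι : K →+* ℂ)
    (d₁ : KolyvaginHeegnerData Dt β ι 1) {M₀ : ℕ}
    (hdiv : ∃ Q : (W.baseChange (ringClassField K ι 1)).toAffine.Point, ((2 ^ M₀ : ℕ) : ℤ) • Q = d₁.derivedPoint)
    (hndiv : ¬ ∃ Q : (W.baseChange (ringClassField K ι 1)).toAffine.Point, ((2 ^ (M₀ + 1) : ℕ) : ℤ) • Q = d₁.derivedPoint)
    (Wd : WeierstrassCurve ℚ) [Wd.IsElliptic] [Wd.IsGloballyMinimal]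
    (hWd : ∃ C : VariableChange ℚ, C • W.quadraticTwist (NumberField.discr K : ℚ) = Wd) (hrd : Wd.analyticRank = 1)
    {qW qd : ℚ} (hqW : shaAn W = (qW : ℂ)) (hqd : shaAn Wd = (qd : ℂ))
    (hShaD : Nat.card (AddCommGroup.primaryComponent (↥Wd.sha) 2) = 1)
    (hShaK : ∀ [Finite (↥W.sha)] [Finite (↥(W.baseChange K).sha)],
      Nat.card (AddCommGroup.primaryComponent (↥(W.baseChange K).sha) 2) = Nat.card (AddCommGroup.primaryComponent (↥W.sha) 2)) :
    2 * (M₀ : ℤ) = padicValRat 2 qW + padicValRat 2 qd := by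
  obtain ⟨qW', hqW', h⟩ := exists_two_mul_depth_eq_padicValRat_add hGZ hGZK hL hMi W hρ2 hT hr0 K hIQ hodd h3 hHe Dt hc β ι d₁ hdiv
    hndiv Wd hWd hrd hqd hShaD hShaK
  have hqq : qW' = qW := Rat.cast_injective (α := ℂ) (hqW'.symm.trans hqW)
  rwa [hqq] at h

end Summit.BirchSwinnertonDyer.BirchSwinnertonDyer.Theorems.GenusExact.ValuationLedger

end
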